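import Mathlib
import Literature.Computability.AlgebraicComplexity.FixedPointLog
import HarnessLib

/-!
# Format C / A′: kernel checker of a JOINT-PHANTOM shift certificate (torus SOS with integer Gram vectors)

Helper file (`--supports stmt-RiemannHypothesis-0098`, lead-track anchor; infrastructure for the
Weil-positivity window ladder, format C far bound), RH-free.  Seat rh-explicit-weil-1 (phantom-ripple format;
memos `run/shared/lean/pub/rh-explicit/rh-explicit-weil-1/WEIL1-SIZELAW.md` §6, `WEIL3-STRUCTURE.md` §9.5–9.6 K2).

THE OBJECT.  For the primes `p = (p₀, p₁, p₂, p₃)` and a window `[−a, a]`, a certificate consists of Gram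
monomials `S_β ∈ ℤ⁴` with integer Gram VECTORS `c_β ∈ ℤ^r` (so `Q = (⟨c_α, c_β⟩)/4^k ⪰ 0` BY CONSTRUCTION — no
`LDLᵀ` in the kernel), found off-line by an SDP (`min D` subject to `D − P₀ + P = mᴴQm` on the 4-torus, `P` a
phantom supported on ADMISSIBLE lattice frequencies `|γ·ℓ| > 2a`, `ℓ = (log p_j)`).  By the transfer principle of
`WeilFormatCJointShiftSOS.lean` (`shiftCorr_gram_nonneg`: `0 ≤ Σ_{α,β} Q_{αβ} I_f((S_β − S_α)·ℓ)`), grouping the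
pairs `(α, β)` by the CANONICAL class `±(S_β − S_α)` gives, for every real bounded measurable `f` vanishing off
`[−a, a]`,  `Σ_n 2Λ(n)/√n · I_f(log n) ≤ D · ∫ f²`  with
`D = g(0) + Σ_{γ ≠ 0, ¬admissible} |t(γ) + g(γ)|` (`g` = class sums of `Q`, `t` = prime weights; admissible
classes drop out because `I_f(u) = 0` for `|u| > 2a`, the others are bounded by `|I_f(u)| ≤ ∫ f²`).

THE CHECKER (this file; pure first-order `ℕ/ℤ/ℚ/List` code for `decide +kernel`): `Cert.check` validates the
cheap structure (prime range hints, the CLAIMED fixed-point enclosures of `log p_j` against the tree's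
`FixedPoint.logNatLo/Hi` of `Literature/Computability/AlgebraicComplexity/FixedPointLog.lean`, the claimed
`⌊2^P √(p_j^e)⌋` by squaring, Gram vector lengths, `Σ dparts ≤ D`), and `Cert.checkPart k` runs the pair pass of
PART `k` (classes with first canonical coordinate `≡ k mod nparts`; one kernel file per part): upper-triangular
pass over the pairs, admissibility by certified integer comparison, accumulation into a class table by linear
search (the `match` in `innerPass`/`outerPass` forces the accumulator at every step), then the certified class
bounds with rational weight brackets.  Soundness: `WeilFormatCJointShiftCertSound.lean`.
-/

set_option linter.dupNamespace false

namespace Summit.RiemannHypothesis.RiemannHypothesis.Theorems.WeilFormatC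

/-- Integer exponent vectors on the 4-torus of the primes `p₀, p₁, p₂, p₃`. [folklore] -/
abbrev ZVec4 := ℤ × ℤ × ℤ × ℤ

namespace JointSOS

/-- Componentwise difference. [folklore] -/
def vsub (u v : ZVec4) : ZVec4 := (u.1 - v.1, u.2.1 - v.2.1, u.2.2.1 - v.2.2.1, u.2.2.2 - v.2.2.2)

/-- Componentwise negation. [folklore] -/
def vneg (u : ZVec4) : ZVec4 := (-u.1, -u.2.1, -u.2.2.1, -u.2.2.2)

/-- Canonical representative of `{d, −d}`: the first nonzero coordinate is made positive. [folklore] -/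
def canon (d : ZVec4) : ZVec4 :=
  if 0 < d.1 then d else if d.1 < 0 then vneg d else
  if 0 < d.2.1 then d else if d.2.1 < 0 then vneg d else
  if 0 < d.2.2.1 then d else if d.2.2.1 < 0 then vneg d else
  if 0 < d.2.2.2 then d else if d.2.2.2 < 0 then vneg d else d

/-- `e · unit(j)` (`j < 4`; anything else ↦ 0). [folklore] -/
def uvec (j : ℕ) (e : ℤ) : ZVec4 :=
  if j = 0 then (e, 0, 0, 0) else if j = 1 then (0, e, 0, 0) else if j = 2 then (0, 0, e, 0)
  else if j = 3 then (0, 0, 0, e) else (0, 0, 0, 0)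

/-- Structural dot product of integer lists (truncating). [folklore] -/
def dotZ : List ℤ → List ℤ → ℤ
  | a :: as, b :: bs => a * b + dotZ as bs
  | _, _ => 0

/-- **The certificate data.** Four primes `p` with range hints `e` (`2^{e_j} ≤ p_j ≤ 2^{e_j+1}`), the window
items `(j, e)` = the prime powers `p_j^e` inside the window (weight `log p_j/√(p_j^e)`, shift `e log p_j`,
exponent vector `e·unit(j)`), the Gram data = pairs (monomial `S_β ∈ ℤ⁴`, Gram VECTOR `c_β ∈ ℤ^r`)
(`Q_{αβ} = ⟨c_α, c_β⟩/4^{kbits}`, positive semidefinite by construction), CLAIMED fixed-point enclosures of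
the four logarithms (validated against the tree's `FixedPoint.logNatLo/Hi`) and of the square roots of the
window prime powers (validated by squaring), the validity bound `aQ` (all windows `[−a, a]` with `a ≤ aQ`) with
its CLAIMED integer form, the number of class PARTS with one claimed bound per part, and the claimed total
constant `D`. [folklore] -/
structure Cert where
  /-- the four primes (torus coordinates) -/
  p : ℕ × ℕ × ℕ × ℕ
  /-- range hints `2^{e_j} ≤ p_j ≤ 2^{e_j+1}` (checked) -/
  e : ℕ × ℕ × ℕ × ℕ
  /-- window items `(j, e)`: the prime power `p_j^e` -/
  window : List (ℕ × ℕ)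
  /-- the Gram data: pairs (monomial exponent vector `S_β`, Gram vector `c_β ∈ ℤ^r`), all `c_β` of one length -/
  mc : List (ZVec4 × List ℤ)
  /-- scaling: `Q = (⟨c_α, c_β⟩)/4^kbits` -/
  kbits : ℕ
  /-- fixed-point precision `P` (bits) of the logarithm enclosures -/
  prec : ℕ
  /-- number of series terms `K` of the logarithm enclosures -/
  terms : ℕ
  /-- CLAIMED lower enclosures `⌊2^P log p_j⌋` (checked against `FixedPoint.logNatLo`) -/
  llo : ℕ × ℕ × ℕ × ℕ
  /-- CLAIMED upper enclosures of `2^P log p_j` (checked against `FixedPoint.logNatHi`) -/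
  lhi : ℕ × ℕ × ℕ × ℕ
  /-- CLAIMED `⌊2^P √(p_j^e)⌋` for each window item, same order (checked by squaring) -/
  wsq : List ℕ
  /-- validity: every window half-width `a ≤ aQ` -/
  aQ : ℚ
  /-- CLAIMED integer threshold `2^{P+1} · num(aQ)` (checked) -/
  thr : ℤ
  /-- CLAIMED denominator of `aQ` (checked) -/
  aden : ℤ
  /-- number of class parts (the pair pass is run once per part, one kernel file each) -/
  nparts : ℕ
  /-- CLAIMED bound of each part (checked per part by `checkPart`) -/
  dparts : List ℚ
  /-- the claimed joint shift constant (`Σ dparts ≤ D`, checked by `check`) -/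
  D : ℚ

namespace Cert

variable (c : Cert)

/-- `j`-th prime. [folklore] -/
def pj (j : ℕ) : ℕ :=
  if j = 0 then c.p.1 else if j = 1 then c.p.2.1 else if j = 2 then c.p.2.2.1 else c.p.2.2.2

/-- `j`-th range hint. [folklore] -/
def ej (j : ℕ) : ℕ :=
  if j = 0 then c.e.1 else if j = 1 then c.e.2.1 else if j = 2 then c.e.2.2.1 else c.e.2.2.2

/-- the claimed lower enclosure of `2^P log p_j` (validated by `logsOK`). [folklore] -/
def logLo (j : ℕ) : ℕ :=
  if j = 0 then c.llo.1 else if j = 1 then c.llo.2.1 else if j = 2 then c.llo.2.2.1 else c.llo.2.2.2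

/-- the claimed upper enclosure of `2^P log p_j` (validated by `logsOK`). [folklore] -/
def logHi (j : ℕ) : ℕ :=
  if j = 0 then c.lhi.1 else if j = 1 then c.lhi.2.1 else if j = 2 then c.lhi.2.2.1 else c.lhi.2.2.2

/-- The claimed enclosures ARE the tree's kernel enclosures `FixedPoint.logNatLo/Hi P K e_j p_j`, and the
claimed integer form of `aQ` is right. [folklore] -/
def logsOK : Bool :=
  decide (c.llo = (Literature.Computability.AlgebraicComplexity.FixedPoint.logNatLo c.prec c.terms (c.ej 0) (c.pj 0),
    Literature.Computability.AlgebraicComplexity.FixedPoint.logNatLo c.prec c.terms (c.ej 1) (c.pj 1),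
    Literature.Computability.AlgebraicComplexity.FixedPoint.logNatLo c.prec c.terms (c.ej 2) (c.pj 2),
    Literature.Computability.AlgebraicComplexity.FixedPoint.logNatLo c.prec c.terms (c.ej 3) (c.pj 3))) &&
  decide (c.lhi = (Literature.Computability.AlgebraicComplexity.FixedPoint.logNatHi c.prec c.terms (c.ej 0) (c.pj 0),
    Literature.Computability.AlgebraicComplexity.FixedPoint.logNatHi c.prec c.terms (c.ej 1) (c.pj 1),
    Literature.Computability.AlgebraicComplexity.FixedPoint.logNatHi c.prec c.terms (c.ej 2) (c.pj 2),
    Literature.Computability.AlgebraicComplexity.FixedPoint.logNatHi c.prec c.terms (c.ej 3) (c.pj 3))) &&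
  decide (c.thr = 2 ^ (c.prec + 1) * c.aQ.num) && decide (c.aden = (c.aQ.den : ℤ))

/-- lower enclosure of `2^P · x · log p_j` for an integer `x`. [folklore] -/
def mulLogLo (j : ℕ) (x : ℤ) : ℤ := if 0 ≤ x then x * (c.logLo j : ℤ) else x * (c.logHi j : ℤ)

/-- upper enclosure of `2^P · x · log p_j`. [folklore] -/
def mulLogHi (j : ℕ) (x : ℤ) : ℤ := if 0 ≤ x then x * (c.logHi j : ℤ) else x * (c.logLo j : ℤ)

/-- lower enclosure of `2^P · γ·ℓ`. [folklore] -/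
def freqLo (γ : ZVec4) : ℤ :=
  c.mulLogLo 0 γ.1 + c.mulLogLo 1 γ.2.1 + c.mulLogLo 2 γ.2.2.1 + c.mulLogLo 3 γ.2.2.2

/-- upper enclosure of `2^P · γ·ℓ`. [folklore] -/
def freqHi (γ : ZVec4) : ℤ :=
  c.mulLogHi 0 γ.1 + c.mulLogHi 1 γ.2.1 + c.mulLogHi 2 γ.2.2.1 + c.mulLogHi 3 γ.2.2.2

/-- The ADMISSIBILITY test: certified `2·aQ < |γ·ℓ|` (integer form: `2^{P+1} num(aQ) < den(aQ)·lo`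
or `den(aQ)·hi < −2^{P+1} num(aQ)`). [folklore] -/
def adm (γ : ZVec4) : Bool :=
  decide (c.thr < c.freqLo γ * c.aden) || decide (c.freqHi γ * c.aden < -c.thr)

/-- A window item with its claimed `⌊2^P √(p_j^e)⌋`: `(j, e, s)`. -/
abbrev WItem := ℕ × ℕ × ℕ

/-- The window items zipped with their claimed square roots. -/
def witems : List WItem := List.zipWith (fun w s ↦ (w.1, w.2, s)) c.window c.wsq

/-- lower bracket of the weight `log p_j / √(p_j^e)` (`s = ⌊2^P √(p_j^e)⌋`). [folklore] -/
def wLo (w : WItem) : ℚ := (c.logLo w.1 : ℚ) / ((w.2.2 : ℚ) + 1)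

/-- upper bracket of the weight `log p_j / √(p_j^e)`. [folklore] -/
def wHi (w : WItem) : ℚ := (c.logHi w.1 : ℚ) / (w.2.2 : ℚ)

/-- A window item is well formed: `j < 4`, `1 ≤ e`, and `s` IS `⌊2^P √(p_j^e)⌋` with `0 < s`. -/
def witemOK (w : WItem) : Bool :=
  decide (w.1 < 4) && decide (1 ≤ w.2.1) && decide (0 < w.2.2) &&
    decide (w.2.2 ^ 2 ≤ c.pj w.1 ^ w.2.1 * 4 ^ c.prec) && decide (c.pj w.1 ^ w.2.1 * 4 ^ c.prec < (w.2.2 + 1) ^ 2)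

/-- All window items well formed. -/
def windowOK : List WItem → Bool
  | [] => true
  | w :: rest => c.witemOK w && windowOK rest

/-- An entry of a class table: canonical frequency vector, accumulated integer Gram mass (doubled off the
diagonal), attached window items. -/
abbrev Entry := ZVec4 × ℤ × List WItem

/-- Accumulate `(γ, v, ws)` into the class table (linear search on `γ`). [folklore] -/
def ins (γ : ZVec4) (v : ℤ) (ws : List WItem) : List Entry → List Entry
  | [] => [(γ, v, ws)]
  | (γ', v', ws') :: rest =>
      if γ = γ' then (γ', v' + v, ws ++ ws') :: rest else (γ', v', ws') :: ins γ v ws rest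

/-- The part of a canonical class: its first coordinate modulo `nparts`. [folklore] -/
def partOf (γ : ZVec4) : ℕ := γ.1.natAbs % c.nparts

/-- One step of the pair pass in part `k`: the pair `(α, β)`, `α ≠ β` (both orientations at once, hence the
factor `2`), is skipped if its canonical difference is admissible or belongs to another part. -/
def step (k : ℕ) (sα : ZVec4) (cα : List ℤ) (sc : ZVec4 × List ℤ) (acc : List Entry) : List Entry :=
  if c.adm (canon (vsub sc.1 sα)) then acc else
    if c.partOf (canon (vsub sc.1 sα)) = k then ins (canon (vsub sc.1 sα)) (2 * dotZ cα sc.2) [] acc else acc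

/-- Inner pass over `β > α`.  (The `match` forces the accumulator to head normal form at every step.) -/
def innerPass (k : ℕ) (sα : ZVec4) (cα : List ℤ) : List (ZVec4 × List ℤ) → List Entry → List Entry
  | [], acc => acc
  | sc :: rest, acc =>
      match c.step k sα cα sc acc with
      | [] => innerPass k sα cα rest []
      | en :: es => innerPass k sα cα rest (en :: es)

/-- The diagonal pair `(α, α)`: class `0`, mass `|c_α|²` (in part `k` iff `partOf 0 = k`). -/
def diagStep (k : ℕ) (cα : List ℤ) (acc : List Entry) : List Entry :=
  if c.partOf (0, 0, 0, 0) = k then ins (0, 0, 0, 0) (dotZ cα cα) [] acc else acc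

/-- Outer pass over `α`, pairing it with itself and every later `β`. -/
def outerPass (k : ℕ) : List (ZVec4 × List ℤ) → List Entry → List Entry
  | [], acc => acc
  | sa :: rest, acc =>
      match c.innerPass k sa.1 sa.2 rest (c.diagStep k sa.2 acc) with
      | [] => outerPass k rest []
      | en :: es => outerPass k rest (en :: es)

/-- The window items of part `k` as synthetic entries `(e·unit(j), 0, [item])` (the canonical vector of the
pair `±e·unit(j)`; it stands for BOTH shifts `±e log p_j`). -/
def windowEntries (k : ℕ) : List WItem → List Entry → List Entry
  | [], acc => acc
  | w :: rest, acc =>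
      windowEntries k rest (if c.partOf (uvec w.1 w.2.1) = k then ins (uvec w.1 w.2.1) 0 [w] acc else acc)

/-- The class table of part `k`. [folklore] -/
def table (k : ℕ) : List Entry := c.outerPass k c.mc (c.windowEntries k c.witems [])

/-- Sum of lower weight brackets of attached items. -/
def wLoSum : List WItem → ℚ
  | [] => 0
  | w :: ws => c.wLo w + wLoSum ws

/-- Sum of upper weight brackets of attached items. -/
def wHiSum : List WItem → ℚ
  | [] => 0
  | w :: ws => c.wHi w + wHiSum ws

/-- The certified bound of one class: `v/4^k + 2Σ wHi` at frequency `0`, else `max |2·wLo/Hi-sum + v/4^k|`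
(an attached window item stands for the two shifts `±e log p_j`, hence the `2`). -/
def entryBound (en : Entry) : ℚ :=
  if en.1 = (0, 0, 0, 0) then (en.2.1 : ℚ) / (4 : ℚ) ^ c.kbits + 2 * c.wHiSum en.2.2
  else max |2 * c.wLoSum en.2.2 + (en.2.1 : ℚ) / (4 : ℚ) ^ c.kbits|
    |2 * c.wHiSum en.2.2 + (en.2.1 : ℚ) / (4 : ℚ) ^ c.kbits|

/-- The plain sum of the class bounds of a table (specification of `tableCheck`'s accumulator). -/
def tableBound : List Entry → ℚ
  | [] => 0
  | en :: rest => c.entryBound en + tableBound rest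

/-- Every attached window item is well formed. -/
def attachedOK : List WItem → Bool
  | [] => true
  | w :: ws => c.witemOK w && attachedOK ws

/-- One pass over a table: attached items well formed AND accumulated bound `≤ bound`. -/
def tableCheck (bound : ℚ) : List Entry → ℚ → Bool
  | [], acc => decide (acc ≤ bound)
  | en :: rest, acc => c.attachedOK en.2.2 && tableCheck bound rest (acc + c.entryBound en)

/-- **Part check** (one kernel file each): the table of part `k` is bounded by the claimed `dparts[k]`. -/
def checkPart (k : ℕ) : Bool := c.tableCheck (c.dparts.getD k 0) (c.table k) 0

/-- All Gram vectors have length `r`. -/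
def colsOK (r : ℕ) : List (ZVec4 × List ℤ) → Bool
  | [] => true
  | sc :: rest => decide (sc.2.length = r) && colsOK r rest

/-- The common length `r` of the Gram vectors (read off the first one). -/
def rank : ℕ := ((c.mc.headD ((0, 0, 0, 0), [])).2).length

/-- Range hints of the four primes. -/
def hintsOK : Bool :=
  Literature.Computability.AlgebraicComplexity.FixedPoint.inRange (c.ej 0) (c.pj 0) &&
  Literature.Computability.AlgebraicComplexity.FixedPoint.inRange (c.ej 1) (c.pj 1) &&
  Literature.Computability.AlgebraicComplexity.FixedPoint.inRange (c.ej 2) (c.pj 2) &&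
  Literature.Computability.AlgebraicComplexity.FixedPoint.inRange (c.ej 3) (c.pj 3)

/-- Sum of a list of rationals (structural). -/
def qsum : List ℚ → ℚ
  | [] => 0
  | q :: qs => q + qsum qs

/-- **The main (cheap) check**: hints, logarithm enclosures, window items, Gram vector lengths, positivity of
`den(aQ)` and of `nparts`, and `Σ dparts ≤ D` with `dparts` of length `nparts`.  The expensive part is
`checkPart k` for each `k < nparts`. [folklore] -/
def check : Bool :=
  c.hintsOK && c.logsOK && decide (c.window.length = c.wsq.length) && c.windowOK c.witems &&
    colsOK c.rank c.mc && decide (0 < c.aden) && decide (0 < c.nparts) &&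
    decide (c.dparts.length = c.nparts) && decide (qsum c.dparts ≤ c.D)

variable {c}

/-! ### Unpacking the structural checks -/

/-- `colsOK_spec` (see the module docstring). [folklore] -/
theorem colsOK_spec {r : ℕ} : ∀ {l : List (ZVec4 × List ℤ)}, colsOK r l = true → ∀ sc ∈ l, sc.2.length = r
  | [], _ => by simp
  | sc :: rest, h => by
      simp only [colsOK, Bool.and_eq_true, decide_eq_true_eq] at h
      intro x hx
      rcases List.mem_cons.1 hx with rfl | hx
      · exact h.1
      · exact colsOK_spec h.2 x hx

/-- `witemOK_spec` (see the module docstring). [folklore] -/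
theorem witemOK_spec {w : WItem} (h : c.witemOK w = true) :
    w.1 < 4 ∧ 1 ≤ w.2.1 ∧ 0 < w.2.2 ∧ w.2.2 ^ 2 ≤ c.pj w.1 ^ w.2.1 * 4 ^ c.prec ∧
      c.pj w.1 ^ w.2.1 * 4 ^ c.prec < (w.2.2 + 1) ^ 2 := by
  simpa [witemOK, Bool.and_eq_true, decide_eq_true_eq, and_assoc] using h

/-- `windowOK_spec` (see the module docstring). [folklore] -/
theorem windowOK_spec : ∀ {l : List WItem}, c.windowOK l = true → ∀ w ∈ l, c.witemOK w = true
  | [], _ => by simp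
  | w :: rest, h => by
      simp only [windowOK, Bool.and_eq_true] at h
      intro x hx
      rcases List.mem_cons.1 hx with rfl | hx
      · exact h.1
      · exact windowOK_spec h.2 x hx

/-- `attachedOK_spec` (see the module docstring). [folklore] -/
theorem attachedOK_spec : ∀ {l : List WItem}, c.attachedOK l = true → ∀ w ∈ l, c.witemOK w = true
  | [], _ => by simp
  | w :: rest, h => by
      simp only [attachedOK, Bool.and_eq_true] at h
      intro x hx
      rcases List.mem_cons.1 hx with rfl | hx
      · exact h.1
      · exact attachedOK_spec h.2 x hx

/-- `tableCheck_spec` (see the module docstring). [folklore] -/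
theorem tableCheck_spec {bound : ℚ} : ∀ {L : List Entry} {acc : ℚ}, c.tableCheck bound L acc = true →
    (∀ en ∈ L, ∀ w ∈ en.2.2, c.witemOK w = true) ∧ acc + c.tableBound L ≤ bound
  | [], acc, h => by
      simp only [tableCheck, decide_eq_true_eq] at h
      exact ⟨by simp, by simpa [tableBound] using h⟩
  | en :: rest, acc, h => by
      simp only [tableCheck, Bool.and_eq_true] at h
      obtain ⟨h1, h2⟩ := h
      obtain ⟨ih1, ih2⟩ := tableCheck_spec h2
      refine ⟨fun x hx ↦ ?_, ?_⟩
      · rcases List.mem_cons.1 hx with rfl | hx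
        · exact attachedOK_spec h1
        · exact ih1 x hx
      · simp only [tableBound]; linarith

/-- `qsum_eq_sum` (see the module docstring). [folklore] -/
theorem qsum_eq_sum : ∀ (l : List ℚ), qsum l = l.sum
  | [] => rfl
  | q :: qs => by rw [qsum, qsum_eq_sum qs, List.sum_cons]


end Cert

end JointSOS

end Summit.RiemannHypothesis.RiemannHypothesis.Theorems.WeilFormatC
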